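import Literature.IUT.LogVolume.CompletionLocalFields
import Literature.IUT.LogVolume.TensorPacketModelScaled
import Literature.IUT.LogVolume.PilotDivisors
import Mathlib.NumberTheory.NumberField.Discriminant.Defs
import HarnessLib

/-!
# `−|log(Θ)|` of [IUTchIII] Cor. 3.12 as a DEFINED real number for a GENUINE tensor-packet instance
# (route D3 `defn-NegLogThetaAtDatum`, part b: the arithmetic input and the number)

[IUTchIII] Cor. 3.12 (kurims May-2020 manuscript p. 173 l. 41 – p. 174 l. 22, read on the page): "Write
`−|log(Θ)| ∈ ℝ ∪ {+∞}` for the procession-normalized mono-analytic log-volume [i.e., where the average is taken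
over `j ∈ 𝔽_l^⋇` …] of the holomorphic hull [cf. Remark 3.9.5, (i)] of the union of the possible images of a
Θ-pilot object [cf. Definition 3.8, (i)], relative to the relevant Kummer isomorphisms [cf. Theorem 3.11, (ii)],
in the multiradial representation of Theorem 3.11, (i), which we regard as subject to the indeterminacies
(Ind1), (Ind2), (Ind3) described in Theorem 3.11, (i), (ii). Write `−|log(q)| ∈ ℝ` for the
procession-normalized mono-analytic log-volume of the image of a `q`-pilot object … which we do not regard as
subject to the indeterminacies … Then it holds that `−|log(Θ)| ∈ ℝ`, and `−|log(Θ)| ≥ −|log(q)|`."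
[IUTchIV] Thm. 1.10, proof, Step (vii) (kurims Apr-2020 manuscript p. 30, read on the page): at `v ∈ 𝕍^arc`
"`π^{j+1}·B_I` serves as a container for the “union of possible images of a Θ-pilot object”", "an upper bound
`(j+1)·log(π)`", "The resulting “procession-normalized upper bound” is given by `((l+5)/4)·log(π)`"; Step
(viii): "it suffices to sum over `v_ℚ ∈ 𝕍_ℚ` the various local “procession-normalized upper bounds” obtained in
Steps (v), (vi), (vii)". Dupuy–Hilado, arXiv:2004.13228 §3.9, §4.7–4.12 (the same quantity at the nonarchimedean
primes as `ln ν̄_𝕃(hull(U_Θ))`, `U_Θ = Ind2(Ind1((O_𝕃(−P_Θ))^{Ind3}))`).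

WHY THIS FILE (cell abc-iut, ledger definition request `defn-NegLogThetaAtDatum`, wanted by the crux
`ThetaPartII` of route `IUTThetaPilot`): so far the cell holds `−|log(Θ)|` only as a FIELD of hypothesis
structures (`Cor312.Setting.negLogTheta`, `Thm110Data`, the glue `thetaRegionOf` of the DH data), so that every
closed form of Cor. 3.12 over them is junk-refutable through the free fields (recorded dead end). Here the number
is DEFINED from GENUINE arithmetic input, at LITERATURE level (a Theses file cannot import the summit-side
`Summits.ABC.IUTFork.*` where the Dupuy–Hilado data `DHData` live; the summit-side bridge
`DHData.ofInput` identifying the two is the companion file `LDHGenuine.lean`):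

* `ThetaVolumeInput F₀ K` — the volume-relevant part of a collection of initial Θ-data ([IUTchI] Def. 3.1)
  over the base `F₀` (in the role of `F_mod`) and the extension field `K` (in the role of `K = F(E_F[l])`): pilot
  data `X = (j_E, S = 𝕍^bad_mod, l)` (c312-3's `PilotData`), a section `σ` of the finite places of `K` over those of
  `F₀` ([IUTchI] Def. 3.1 (e) `V̲ ⥲ V_mod`, abc-iut-S2's `PlaceSection`), and — the only non-canonical choice —
  the IDELES `t_Θ = (t_{Θ,j,v̲})`, `t_q` in the units of the GENUINE completions `K_{v̲}` realising the pilot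
  valuations `ord_v(t_{Θ,j,v}) = j²·ord_v(q_v)/(2l)`, `ord_v(t_{q,v}) = ord_v(q_v)/(2l)` ([IUTchI] Ex. 3.2 (iv)
  "`q̲_v := q_v^{1/2l}`"; Dupuy–Hilado §3.9 "let `a = (a_{v̲}) ∈ 𝔸_{V̲}` be such that `D = div(a)`"). Their
  EXISTENCE (a `2l`-th root of the Tate parameter in `K_{v̲}`) is Tate-uniformisation-grade input, not assumed
  here: it is what an inhabitant carries.
* the `p`-local quantities over any prime packet `Q` (Literature-level twins of c312-3's summit-side
  `PrimePacket.regionOf/localUTheta/localHull`, which a Literature module cannot import; the companion proves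
  them equal by `rfl`): `pilotRegion t` = `O_𝕃(−div t)_p`, `possibleImages B = ⋃_{g,σ} g·σ·B` ((Ind2)∘(Ind1)),
  `possibleImagesHull`, and `negLogThetaAt l⋇ t := ln ν̄_{𝕃_p}(hull(⋃_{g,σ} g·σ·O_𝕃(−div t)_p))`;
* `negLogThetaNonarch I := Σ_{p ∈ T(I)} negLogThetaAt` over the REAL packets `realPrimePacketM p (σ.localFields p)`
  (Mochizuki's log-shell normalisation `p^{−⌈d_I+a_I⌉}·log_p(R_I^×)`, c312-3's `TensorPacketModelScaled`, in which
  the MINIMAL = SHARP (Ind3)-datum `(O_𝕃(−P_Θ))^{Ind3} := O_𝕃(−P_Θ)` exists from the ideles alone — the cell's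
  planner ruling R6-b: the main line quantifies over sharp data; the shell-inclusive alternative is recorded by
  `LDHWitnessEstimate`), summed over `T(I) :=` the prime factors of `2·|disc K|` and the residue characteristics
  of `S` (every other summand vanishes: odd, unramified, prime to `𝔮` — [IUTchIV] Step (vi), abc-iut-S2's
  `LDHHullSupport`); `archLogTheta l := ((l+5)/4)·log π`, the archimedean summand in the CLOSED FORM printed in
  Step (vii) (it IS the genuine Haar log-volume of the genuine archimedean hull `π^{j+1}·B_I`, procession- and
  weight-normalised: abc-iut-L5-t7's `ArchPacket.nlogVol`, `holomorphicHull_image_eq`,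
  `procAvg_nlogVol_holomorphicHull_eq`); **`negLogTheta I := negLogThetaNonarch I + archLogTheta l`**;
* `negAbsLogQ I := −deĝ̲(P_q) = −(1/2l)·log(q)` ("`−|log(q)|`", [IUTchIV] p. 23 l. 27–30: "`|log(q)|` … is equal
  to `(1/2l)·log(q)`"); the CLAIM-form Props `Cor312Of I` ("`−|log(Θ)| ≥ −|log(q)|`", disputed, never asserted),
  its nonarchimedean form `Cor312NonarchOf I` (Dupuy–Hilado's (1.1) verbatim, the stronger of the two),
  and `HullEstimateOf I δ` (the computable half, [IUTchIV] Thm. 1.10 Steps (v)–(viii) shape).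

[cite: Mochizuki2012, IUTchIII Cor. 3.12 p. 173–174] [cite: Mochizuki2012, IUTchIV Thm. 1.10 Step (vii) p. 30]
[cite: DupuyHilado2025, §3.9, §4.10–4.12] [claim: Mochizuki2012, status: disputed] for every IUT quotation.
An instance ≠ an endorsement; nothing here asserts `Cor312Of` for any input. Deliberately NOT here: the
point-level specialisation to `(P, l)` on the `λ`-line (companion `GenuineLogThetaPoint.lean`), the summit-side
bridge to `DHData` (`LDHGenuine.lean`), the existence of ideles, anything about which (Ind3) reading is the text's.
-/

noncomputable section

namespace Literature.IUT.LogVolume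

open NumberField IsDedekindDomain Set
open scoped Pointwise

universe u

/-! ## `p`-local quantities over a prime packet -/

namespace PrimePacket

variable {F : Type u} [Field F] [NumberField F] {p : ℕ} (Q : PrimePacket F p)

/-- `O_𝕃(−div t)_p` for a `p`-local lgp-idele `t = (t_{j,v})`: in the summand `X_{(v_0,…,v_j)}` of degree
`j = i+1 ∈ {1,…,ℓ⋇}` the translate `t_{j,v_j}·O_{v⃗}` (peel action at the last index), `O_{v⃗}` in the degrees not
occurring in `𝕃_p` (Dupuy–Hilado §3.9; Literature-level twin of c312-3's summit-side `PrimePacket.regionOf`, same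
formula). [cite: DupuyHilado2025, §3.9] -/
def pilotRegion {lstar : ℕ} (t : Fin lstar → (v : placesOver F p) → Q.Λ v) : Q.Region := fun j e =>
  if h : 0 < j ∧ j - 1 < lstar then Q.peel (t ⟨j - 1, h.2⟩ (e (Fin.last j))) '' Q.O j e else Q.O j e

/-- **The union of the possible images** of a region under the indeterminacies, summand by summand:
`⋃_{g ∈ G₂(v⃗), σ ∈ 𝔖_{j+1}} g·(σ·B)_{v⃗}` — (Ind1) = permutations of the tensor factors, then (Ind2) = the group
`Aut(X_{v⃗} : I_{v⃗})` (Dupuy–Hilado §4.7, §4.9, §4.11 "`U_Θ = Ind2(Ind1((O_𝕃(−P_Θ))^{Ind3}))`"; [IUTchIII] Cor. 3.12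
"the union of the possible images of a Θ-pilot object … subject to the indeterminacies (Ind1), (Ind2), (Ind3)";
twin of c312-3's `PrimePacket.localUTheta`). [cite: DupuyHilado2025, §4.11] -/
def possibleImages (B : Q.Region) : Q.Region := fun j e =>
  ⋃ (g : Q.G₂ j e) (σ : Equiv.Perm (Fin (j + 1))), g • (Q.perm σ e '' B j (e ∘ σ))

/-- **The holomorphic hull of the union of the possible images**, summand by summand ([IUTchIII] Rmk. 3.9.5 (i);
Dupuy–Hilado §4.12 "`hull(Ω) := Π_p hull(Ω_p)`"; twin of c312-3's `PrimePacket.localHull`).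
[cite: DupuyHilado2025, §4.12] -/
def possibleImagesHull (B : Q.Region) : Q.Region := fun j e => Q.hullLoc j e (Q.possibleImages B j e)

/-- **`−|log(Θ)|` at the index `p` for the SHARP (minimal) (Ind3)-datum**: the procession-normalised log-volume
`ln ν̄_{𝕃_p}` (Dupuy–Hilado Def. 3.6.3; [IUTchIII] Prop. 3.9 (i)–(ii), Rmk. 3.1.1 (ii)–(iv)) of the hull of the union of
the possible images of `O_𝕃(−div t_Θ)_p`. [cite: DupuyHilado2025, §1 (1.1), §4.11–4.12] -/
def negLogThetaAt (lstar : ℕ) (t : Fin lstar → (v : placesOver F p) → Q.Λ v) : ℝ :=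
  Q.lnνLp lstar (Q.possibleImagesHull (Q.pilotRegion t))

/-- **`−|log(q)|` at the index `p`**: `ln ν̄_{𝕃_p}(O_𝕃(−div t_q)_p)` — the `q`-pilot "which we do not regard as subject
to the indeterminacies" ([IUTchIII] Cor. 3.12). [cite: DupuyHilado2025, §3.9] -/
def negAbsLogQAt (lstar : ℕ) (t : Fin lstar → (v : placesOver F p) → Q.Λ v) : ℝ :=
  Q.lnνLp lstar (Q.pilotRegion t)

/-- The bare region lies in the union of its possible images (identity indeterminacies).
[cite: DupuyHilado2025, §4.11] -/
theorem subset_possibleImages (B : Q.Region) (j : ℕ) (e : Fin (j + 1) → placesOver F p) :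
    B j e ⊆ Q.possibleImages B j e := by
  intro x hx
  refine mem_iUnion.mpr ⟨1, mem_iUnion.mpr ⟨1, ?_⟩⟩
  rw [one_smul]
  exact ⟨x, hx, Q.perm_one e x⟩

/-- The union of the possible images lies in its hull. [cite: DupuyHilado2025, §4.12] -/
theorem possibleImages_subset_hull (B : Q.Region) (j : ℕ) (e : Fin (j + 1) → placesOver F p) :
    Q.possibleImages B j e ⊆ Q.possibleImagesHull B j e :=
  (Q.hullLoc j e).le_closure _

end PrimePacket

/-! ## The genuine input: the volume-relevant part of a collection of initial Θ-data -/

variable (F₀ : Type) [Field F₀] [NumberField F₀] (K : Type) [Field K] [NumberField K] [Algebra F₀ K]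

/-- **A genuine Θ-volume input over `F₀` with extension field `K`** (`F₀` in the role of `F_mod`, `K` in the role
of `K = F(E_F[l])` of [IUTchI] Def. 3.1 (c)): the part of a collection of initial Θ-data
`(F̄/F, X_F, l, C̲_K, V̲, V^bad_mod, ε̲)` ([IUTchI] Def. 3.1) — together with the ideles of Dupuy–Hilado §3.9 / the
`q̲_v` of [IUTchI] Ex. 3.2 (iv) — that the log-volumes of [IUTchIII] Cor. 3.12 are computed from:
* `X` — the pilot data `(j_E ∈ F₀, S = 𝕍^bad_mod ≠ ∅ with ord_v(j_E) < 0, l ≥ 5 prime)` (c312-3's `PilotData`);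
* `σ` — a section `v ↦ v̲` of the finite places of `K` over those of `F₀` ([IUTchI] Def. 3.1 (e), nonarchimedean
  part of "`V̲ ⥲ V_mod`");
* `tΘ`, `tq` — for every prime `p`, procession index `j = i+1` and `v ∈ V(F₀)_p`, UNITS of the genuine completion
  `K_{v̲}` (`σ.localFields p`, abc-iut-S7's `RescaledCompletion`) with `ord_v(t_{Θ,j,v}) = j²·ord_v(q_v)/(2l)` and
  `ord_v(t_{q,v}) = ord_v(q_v)/(2l)` — the coefficients of the Θ- and `q`-pilot divisors (`ord_v` normalised to
  `F₀`, c312-3's `LocalFields.ordv`). INPUT, not constructed: an inhabitant carries `2l`-th roots of the Tate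
  parameters in `K_{v̲}` (classical: Tate uniformisation + `E[2l]`-structure of the fields of initial Θ-data).
[cite: Mochizuki2012, IUTchI Def. 3.1 p. 61–62] [cite: DupuyHilado2025, §3.3, §3.9] -/
structure ThetaVolumeInput : Type where
  /-- the pilot data `(j_E, S, l)` over `F₀` -/
  X : PilotData F₀
  /-- the section `v ↦ v̲` of finite places -/
  σ : PlaceSection F₀ K
  /-- the Θ-idele: `t_{Θ,j,v} ∈ K_{v̲}^×` at every prime `p`, `j = i+1 ≤ ℓ⋇`, `v | p` -/
  tΘ : ∀ (p : ℕ) (hp : p.Prime), Fin X.lstar → (v : placesOver F₀ p) →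
    (@LocalFields.k F₀ _ _ p ⟨hp⟩ (σ.localFieldFamily p hp) v)ˣ
  /-- it realises `P_Θ`: `ord_v(t_{Θ,j,v}) = j²·ord_v(q_v)/(2l)` on `S`, `0` off `S` -/
  tΘ_ord : ∀ (p : ℕ) (hp : p.Prime) (i : Fin X.lstar) (v : placesOver F₀ p),
    @LocalFields.ordv F₀ _ _ p ⟨hp⟩ (σ.localFieldFamily p hp) v (tΘ p hp i v) = X.thetaPilot i v.1
  /-- the `q`-idele: `t_{q,v} ∈ K_{v̲}^×` (the same in every procession degree) -/
  tq : ∀ (p : ℕ) (hp : p.Prime), Fin X.lstar → (v : placesOver F₀ p) →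
    (@LocalFields.k F₀ _ _ p ⟨hp⟩ (σ.localFieldFamily p hp) v)ˣ
  /-- it realises `P_q`: `ord_v(t_{q,v}) = ord_v(q_v)/(2l)` on `S`, `0` off `S` -/
  tq_ord : ∀ (p : ℕ) (hp : p.Prime) (i : Fin X.lstar) (v : placesOver F₀ p),
    @LocalFields.ordv F₀ _ _ p ⟨hp⟩ (σ.localFieldFamily p hp) v (tq p hp i v) = X.qPilot v.1

namespace ThetaVolumeInput

variable {F₀ K} (I : ThetaVolumeInput F₀ K)

/-- `l` of the input. [cite: Mochizuki2012, IUTchI Def. 3.1 (c) p. 61] -/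
abbrev l : ℕ := I.X.l

/-- `ℓ⋇ = (l−1)/2`, the procession length. [cite: DupuyHilado2025, §3.3] -/
abbrev lstar : ℕ := I.X.lstar

/-- **The primes carrying `−|log(Θ)|`**: the prime factors of `2·|disc K|` (the prime `2` and the primes ramified
in `K`) together with the residue characteristics of the bad places `S` — [IUTchIV] Thm. 1.10's "distinguished"
`𝕍^dst`: at every other prime (odd, unramified in `K`, prime to `𝔮`) the summand of `−|log(Θ)|` vanishes (Step (vi):
the log-shell is `O`, the hull of the possible images of `O` is `O`, log-volume `0`).
[cite: Mochizuki2012, IUTchIV Thm. 1.10 Step (vi) p. 29] -/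
def supportPrimes : Finset ℕ :=
  (2 * (NumberField.discr K).natAbs).primeFactors ∪ I.X.S.image (residueChar F₀)

/-- Every member of `supportPrimes` is a prime. [cite: Mochizuki2012, IUTchIV Thm. 1.10 Step (vi) p. 29] -/
theorem prime_of_mem_supportPrimes {p : ℕ} (hp : p ∈ I.supportPrimes) : p.Prime := by
  rcases Finset.mem_union.mp hp with h | h
  · exact Nat.prime_of_mem_primeFactors h
  · obtain ⟨v, _, rfl⟩ := Finset.mem_image.mp h
    exact residueChar_prime F₀ v

/-- The residue characteristics of the bad places are support primes (Dupuy–Hilado's `T ⊇ {p_v : v ∈ S}`).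
[cite: DupuyHilado2025, §3.9] -/
theorem residueChar_mem_supportPrimes {v : HeightOneSpectrum (𝓞 F₀)} (hv : v ∈ I.X.S) :
    residueChar F₀ v ∈ I.supportPrimes :=
  Finset.mem_union_right _ (Finset.mem_image_of_mem _ hv)

/-- `2` is a support prime. [cite: Mochizuki2012, IUTchIV Thm. 1.10 Step (vi) p. 29] -/
theorem two_mem_supportPrimes : 2 ∈ I.supportPrimes := by
  refine Finset.mem_union_left _ (Nat.mem_primeFactors.mpr ⟨Nat.prime_two, dvd_mul_right 2 _, ?_⟩)
  exact mul_ne_zero two_ne_zero (Int.natAbs_ne_zero.mpr (NumberField.discr_ne_zero K))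

/-- The real prime packet of the input at `p`: the tensor packets of the GENUINE completions `K_{v̲}`, `v ∈ V(F₀)_p`,
in Mochizuki's log-shell normalisation (c312-3's `realPrimePacketM`). [cite: Mochizuki2012, IUTchIV Prop. 1.2 (ii) p. 10] -/
def packetAt (p : ℕ) (hp : p.Prime) : PrimePacket F₀ p :=
  @realPrimePacketM F₀ _ _ p ⟨hp⟩ (I.σ.localFieldFamily p hp)

/-- The summand of `−|log(Θ)|` at the index `p` (`0` at a non-prime index, never summed).
[cite: DupuyHilado2025, Def. 3.6.3, §4.11–4.12] -/
def negLogThetaLoc (p : ℕ) : ℝ :=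
  if hp : p.Prime then (I.packetAt p hp).negLogThetaAt I.lstar (I.tΘ p hp) else 0

/-- The summand of `−|log(q)|` at the index `p`. [cite: DupuyHilado2025, Def. 3.6.3, §3.9] -/
def negAbsLogQLoc (p : ℕ) : ℝ :=
  if hp : p.Prime then (I.packetAt p hp).negAbsLogQAt I.lstar (I.tq p hp) else 0

/-- At a prime the local summand is the packet-level quantity. [cite: DupuyHilado2025, Def. 3.6.3] -/
theorem negLogThetaLoc_of_prime {p : ℕ} (hp : p.Prime) :
    I.negLogThetaLoc p = (I.packetAt p hp).negLogThetaAt I.lstar (I.tΘ p hp) := by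
  rw [negLogThetaLoc, dif_pos hp]

/-- At a prime the local `q`-summand is the packet-level quantity. [cite: DupuyHilado2025, Def. 3.6.3] -/
theorem negAbsLogQLoc_of_prime {p : ℕ} (hp : p.Prime) :
    I.negAbsLogQLoc p = (I.packetAt p hp).negAbsLogQAt I.lstar (I.tq p hp) := by
  rw [negAbsLogQLoc, dif_pos hp]

/-- **The nonarchimedean part of `−|log(Θ)|`**: `Σ_{p ∈ T(I)} ln ν̄_{𝕃_p}(hull(U_Θ)_p)` for the sharp datum over the
genuine completions. [cite: DupuyHilado2025, §1 (1.1), Def. 3.6.3] -/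
def negLogThetaNonarch : ℝ := ∑ p ∈ I.supportPrimes, I.negLogThetaLoc p

/-- **The archimedean part of `−|log(Θ)|`** in the closed form printed in [IUTchIV] Thm. 1.10 Step (vii) (p. 30):
at each `v ∈ 𝕍^arc` the hull of the possible images in the `(j+1)`-fold packet is `π^{j+1}·B_I`, of log-volume
`(j+1)·log(π)` ("the log-volume of `B_I` is equal to `0`"), and the weighted, procession-normalised average is
`(1/ℓ⋇)·Σ_{j=1}^{ℓ⋇} (j+1)·log(π) = ((l+5)/4)·log(π)`. (The identification with the genuine Haar functional on the
complex packets is abc-iut-L5-t7's `procAvg_nlogVol_holomorphicHull_eq`, `ArchimedeanPacketLogVolume/Hull`.)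
[cite: Mochizuki2012, IUTchIV Thm. 1.10 Step (vii) p. 30] -/
def archLogTheta (l : ℕ) : ℝ := ((l : ℝ) + 5) / 4 * Real.log Real.pi

/-- The archimedean part is positive (`π > 1`). [cite: Mochizuki2012, IUTchIV Thm. 1.10 Step (vii) p. 30] -/
theorem archLogTheta_pos (l : ℕ) : 0 < archLogTheta l := by
  unfold archLogTheta
  have hπ : 1 < Real.pi := by linarith [Real.pi_gt_three]
  exact mul_pos (by positivity) (Real.log_pos hπ)

/-- **`−|log(Θ)|`** of [IUTchIII] Cor. 3.12 for the input `I`: nonarchimedean part plus archimedean part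
([IUTchIV] Thm. 1.10 Step (viii): "sum over `v_ℚ ∈ 𝕍_ℚ` the various local … bounds obtained in Steps (v), (vi),
(vii)"). [cite: Mochizuki2012, IUTchIII Cor. 3.12 p. 173–174] -/
def negLogTheta : ℝ := I.negLogThetaNonarch + archLogTheta I.l

/-- **`−|log(q)|`** of [IUTchIII] Cor. 3.12 for the input `I`: `−deĝ̲(P_q)`, i.e. `−(1/2l)·log(q)` ([IUTchIV] p. 23
l. 27–30: "the quantity “`|log(q)|`” … is equal to `(1/2l)·log(q)`"; its archimedean part is `0`).
[cite: Mochizuki2012, IUTchIV Thm. 1.10 p. 23] -/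
def negAbsLogQ : ℝ := -FinDivisor.ndeg F₀ I.X.qPilot

/-- `−|log(q)| = −(1/2l)·deĝ̲(𝔮)` with `𝔮 = Σ_{v∈S} ord_v(q_v)[v]` the `q`-parameter divisor (`log(q) = deĝ̲(𝔮)`).
[cite: Mochizuki2012, IUTchIV Thm. 1.10 p. 23] -/
theorem negAbsLogQ_eq : I.negAbsLogQ = -(1 / (2 * (I.l : ℝ))) * FinDivisor.ndeg F₀ I.X.qDivisor := by
  rw [negAbsLogQ, PilotData.qPilot_eq_smul, map_smul, smul_eq_mul, neg_mul]

/-- `|log(q)| > 0` ("`|log(q)| > 0` is easily computed in terms of the various `q`-parameters … at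
`v ∈ 𝕍^bad (≠ ∅)`", Cor. 3.12). [cite: Mochizuki2012, IUTchIII Cor. 3.12 p. 174] -/
theorem negAbsLogQ_neg : I.negAbsLogQ < 0 := by
  rw [negAbsLogQ, neg_lt_zero, FinDivisor.ndeg_apply]
  exact div_pos I.X.deg_qPilot_pos (by exact_mod_cast Module.finrank_pos)

/-- **[IUTchIII] Corollary 3.12 FOR THE INPUT `I`** — "`−|log(Θ)| ≥ −|log(q)|`" with both sides the DEFINED numbers
of this file (sharp (Ind3) reading). A `Prop`, the cell's CLAIM form: DISPUTED in print (Scholze–Stix 2018 §2.2),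
never asserted here. [claim: Mochizuki2012, status: disputed] -/
@[claim "Mochizuki2012" "disputed"]
def Cor312Of : Prop := I.negAbsLogQ ≤ I.negLogTheta

/-- **Dupuy–Hilado's (1.1) for the input `I`** — the NONARCHIMEDEAN form "`−deĝ̲(P_q) ≤ ln ν̄_𝕃(hull(U_Θ))`"
(arXiv:2004.13228 §1 (1.1); Scholze–Stix 2018 (1.4) `−|log(q)| ≤ −|log(Θ)|` without the archimedean summand):
`−|log(q)| ≤ negLogThetaNonarch I`. It IMPLIES `Cor312Of I` (the archimedean summand is `> 0`,
`cor312Of_of_cor312NonarchOf`) and is the form the summit-side `DHData.Cor312DH` transcribes (bridge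
`LDHGenuine.cor312DH_ofInput_iff`). A `Prop`, never asserted. [claim: Mochizuki2012, status: disputed] -/
@[claim "Mochizuki2012" "disputed"]
def Cor312NonarchOf : Prop := I.negAbsLogQ ≤ I.negLogThetaNonarch

/-- The nonarchimedean form implies [IUTchIII] Cor. 3.12 for the input (add the positive archimedean summand).
[cite: Mochizuki2012, IUTchIV Thm. 1.10 Step (vii) p. 30] -/
theorem cor312Of_of_cor312NonarchOf (h : I.Cor312NonarchOf) : I.Cor312Of := by
  unfold Cor312NonarchOf at h
  unfold Cor312Of negLogTheta
  linarith [archLogTheta_pos I.l]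

/-- **The computable half for the input `I`** ([IUTchIV] Thm. 1.10 Steps (v)–(viii) shape; Dupuy–Hilado's
`EstimateDH`): the nonarchimedean part of `−|log(Θ)|` is at most `−deĝ̲_lgp(P_Θ) + δ`. A `Prop` to be PROVED for
explicit `δ` (summit-side: c312-d1's `estimateDH_ofTensor_of_sharp` through the bridge `LDHGenuine`).
[cite: Mochizuki2012, IUTchIV Thm. 1.10 Steps (v)–(viii) p. 27–31] -/
def HullEstimateOf (δ : ℝ) : Prop := I.negLogThetaNonarch ≤ -LgpDivisor.ndegLgp I.X.thetaPilot + δ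

/-- The squeeze, as bookkeeping: IF Cor. 3.12 holds for `I` AND the hull estimate holds with `δ`, then
`deĝ̲_lgp(P_Θ) − deĝ̲(P_q) ≤ δ + ((l+5)/4)·log π` (the gap the indeterminacies must inflate is paid by `δ` and the
archimedean term). Pure arithmetic of the two `Prop`s; no side taken. [cite: DupuyHilado2025, §1 (1.1)] -/
theorem gap_le_of_cor312Of_of_hullEstimateOf {δ : ℝ} (h1 : I.Cor312Of) (h2 : I.HullEstimateOf δ) :
    LgpDivisor.ndegLgp I.X.thetaPilot - FinDivisor.ndeg F₀ I.X.qPilot ≤ δ + archLogTheta I.l := by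
  unfold Cor312Of negLogTheta negAbsLogQ at h1
  unfold HullEstimateOf at h2
  linarith

end ThetaVolumeInput

end Literature.IUT.LogVolume

end
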